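import Mathlib
import Summits.Ventures.PercRepro2.ZMeanProof
import Summits.Ventures.PercRepro2.PendantRoot
import Summits.Ventures.PercRepro2.HMFLeaf
import Summits.Ventures.PercRepro2.HMFPendantBEvents
import Summits.Ventures.PercRepro2.HMFPendantB

/-!
# (HMF) at a pendant `a₃` attached to `o` — the mean field from cross-cluster BHK alone
(blind cell PercRepro2, night-1 g6; NIGHT1-G6.md §10)

Let `a₃` be a LEAF attached to `o` by the single edge `f` of weight `q`, with `o, b, a₁, a₂ ≠ a₃`.
When `f` is open, `C(a₃) = C(o)` contains `o`, and every row of the mean field `X̂` indexed by a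
cluster containing `o` vanishes (the factor `1_{o ∉ A}`): `X̂ = (1 − q) · termW({a₃})`.  The masses
of `HMFc` are the pendant-`b` masses of `HMFPendantBEvents` with `b := o`, and everything collapses to

  `HMFc = 2 q (1 − q) · (A_L + A_H) · (s_LH + s_HL)`,
  `s_LH = P(Q,oL) P(Q,bH) − P(Q) P(Q,bH,oL) ≥ 0`,  `s_HL = P(Q,oH) P(Q,bL) − P(Q) P(Q,bL,oH) ≥ 0`

(the two cross-cluster BHK slacks, `PendantRoot.covC_cross_nonpos`).  Hence **`HMF_pendant_o`**: the
mean-field statement (HMF) holds at every pendant `a₃` at `o`, and `HCov_pendant_o'` is a second proof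
of the pendant-`o` attachment case of (HCOV).  Identity checked exactly on 370 instances (pendo_verify.py)
before the formalisation; the certificate was found by linear programming (pendo_lp.py).  The file
declares no definition: the attachment functional `(A_L + A_H)(s_LH + s_HL)` is written out.
-/

namespace Summit.Ventures.PercRepro2

open UnionCluster CovForm PendantRoot

namespace HMFPendantO

open HMFPendantRoot HMFPendantB

variable {V : Type*} {E : Type*} [Fintype E] [DecidableEq E] [Fintype V] [DecidableEq V]
  {R : Type*} [Field R] [LinearOrder R] [IsStrictOrderedRing R]

variable (p : E → R) (ends : E → Sym2 V) {f : E} {a₃ o : V}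

omit [LinearOrder R] [IsStrictOrderedRing R] in
/-- A cluster containing `o` contributes nothing to `X̂` (the factor `1_{o ∉ A}` of the mean field). -/
lemma termW_eq_zero_of_mem {W : Finset V} (hoW : o ∈ W) (a₁ a₂ b : V) :
    termW p ends o a₁ a₂ b W = 0 := by
  unfold termW termT termPD delConnProb delShareMass
  simp [hoW]

omit [LinearOrder R] [IsStrictOrderedRing R] in
/-- The rows of `X̂` indexed by `C(o)` vanish: `o` lies in its own cluster. -/
lemma sum_cluster_o_termW (a₁ a₂ b : V) (A : Set (Config E)) :
    ∑ W : Finset V, prob p (clusterEvent ends o (↑W : Set V) ∩ A) * termW p ends o a₁ a₂ b W = 0 := by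
  refine Finset.sum_eq_zero fun W _ => ?_
  by_cases hoW : o ∈ W
  · rw [termW_eq_zero_of_mem p ends hoW, mul_zero]
  · have : clusterEvent ends o (↑W : Set V) ∩ A = ∅ := by
      ext ω
      simp only [Set.mem_inter_iff, mem_clusterEvent, Set.mem_empty_iff_false, iff_false, not_and]
      intro h _
      apply hoW
      have : o ∈ cluster ends ω o := conn_refl ends ω o
      rw [h] at this
      exact Finset.mem_coe.1 this
    rw [this, prob_empty, zero_mul]

omit [LinearOrder R] [IsStrictOrderedRing R] in
/-- **`X̂ = (1 − q) · termW({a₃})` at a pendant `o`**: the open rows vanish. -/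
lemma Xhat_pendant_o (hf : ends f = s(a₃, o)) (hleaf : ∀ e, a₃ ∈ ends e → e = f) (h3o : a₃ ≠ o)
    (a₁ a₂ b : V) :
    Xhat p ends o a₁ a₂ a₃ b = (1 - p f) * termW p ends o a₁ a₂ b {a₃} := by
  rw [Xhat_eq_sum]
  have hsplit : ∀ W : Finset V, prob p (clusterEvent ends a₃ (↑W : Set V)) =
      prob p (clusterEvent ends o (↑W : Set V) ∩ openEdge f) +
        (if (↑W : Set V) = {a₃} then prob p (closedEdge f) else 0) := by
    intro W
    rw [← prob_inter_add_prob_inter_compl p (clusterEvent ends a₃ (↑W : Set V)) (openEdge f),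
      ← closedEdge_eq_compl, clusterEvent_leaf_inter_open hf,
      clusterEvent_leaf_inter_closed hf hleaf h3o]
    congr 1
    split_ifs <;> simp
  simp only [hsplit, add_mul, Finset.sum_add_distrib]
  rw [sum_cluster_o_termW p ends a₁ a₂ b (openEdge f), zero_add,
    Finset.sum_eq_single ({a₃} : Finset V)]
  · simp [prob_closedEdge]
  · intro W _ hW
    have : (↑W : Set V) ≠ {a₃} := by
      intro h
      apply hW
      rw [← Finset.coe_singleton] at h
      exact Finset.coe_injective h
    simp [this]
  · intro h
    exact absurd (Finset.mem_univ _) h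

/-- `P(Q) · termW({a₃}) = P(Q,oL) P(Q,bH) + P(Q,oH) P(Q,bL)` at a pendant `o`. -/
lemma termW_leaf_o (hp : IsProbVec p) (hf : ends f = s(a₃, o)) (hleaf : ∀ e, a₃ ∈ ends e → e = f)
    (h3o : a₃ ≠ o) {a₁ a₂ b : V} (h31 : a₃ ≠ a₁) (h32 : a₃ ≠ a₂) (hb : b ≠ a₃) :
    prob p (avoidAll ends a₂ {a₁}) * termW p ends o a₁ a₂ b {a₃} =
      prob p (avoidAll ends a₂ {a₁} ∩ connEvent ends a₁ o) *
          prob p (avoidAll ends a₂ {a₁} ∩ connEvent ends a₂ b) +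
        prob p (avoidAll ends a₂ {a₁} ∩ connEvent ends a₂ o) *
          prob p (avoidAll ends a₂ {a₁} ∩ connEvent ends a₁ b) := by
  have h1 : a₁ ∉ ({a₃} : Finset V) := by simp [Ne.symm h31]
  have h2 : a₂ ∉ ({a₃} : Finset V) := by simp [Ne.symm h32]
  have ho' : o ∉ ({a₃} : Finset V) := by simp [Ne.symm h3o]
  have hb' : b ∉ ({a₃} : Finset V) := by simp [hb]
  simp only [termW, h1, h2, if_false, termPD, delShareMass, ho', hb',
    delQ_leaf_b ends hf hleaf h3o h31 h32, connDelEvent_leaf hf hleaf h3o (Ne.symm h31) (Ne.symm h3o),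
    connDelEvent_leaf hf hleaf h3o (Ne.symm h32) hb,
    connDelEvent_leaf hf hleaf h3o (Ne.symm h32) (Ne.symm h3o), connDelEvent_leaf hf hleaf h3o (Ne.symm h31) hb]
  by_cases hZ : prob p (avoidAll ends a₂ {a₁}) = 0
  · have hmono : ∀ X, prob p (avoidAll ends a₂ {a₁} ∩ X) = 0 := fun X =>
      le_antisymm (by rw [← hZ]; exact prob_mono hp Set.inter_subset_left) (prob_nonneg hp _)
    simp [hZ, hmono]
  · rw [mul_div_cancel₀ _ hZ]

/-- **The first-order attachment functional at `o` is nonnegative**: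
`(A_L + A_H) · (s_LH + s_HL) ≥ 0` with the cross-cluster slacks `s_LH = A_L B_H − Z x_LH`,
`s_HL = A_H B_L − Z x_HL` (both `≥ 0` by `covC_cross_nonpos`). -/
theorem attO_nonneg (hp : IsProbVec p) (o a₁ a₂ b : V) :
    0 ≤ ((prob p (avoidAll ends a₂ {a₁} ∩ connEvent ends a₁ o) +
          prob p (avoidAll ends a₂ {a₁} ∩ connEvent ends a₂ o)) *
        ((prob p (avoidAll ends a₂ {a₁} ∩ connEvent ends a₁ o) *
              prob p (avoidAll ends a₂ {a₁} ∩ connEvent ends a₂ b) -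
            prob p (avoidAll ends a₂ {a₁}) *
              prob p (avoidAll ends a₂ {a₁} ∩ connEvent ends a₂ b ∩ connEvent ends a₁ o)) +
          (prob p (avoidAll ends a₂ {a₁} ∩ connEvent ends a₂ o) *
              prob p (avoidAll ends a₂ {a₁} ∩ connEvent ends a₁ b) -
            prob p (avoidAll ends a₂ {a₁}) *
              prob p (avoidAll ends a₂ {a₁} ∩ connEvent ends a₁ b ∩ connEvent ends a₂ o)))) := by
  obtain ⟨cHL, cLH⟩ := covC_cross_nonpos p ends hp o a₁ a₂ b
  unfold covC at cHL cLH
  rw [swap_atom] at cHL cLH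
  have hL := prob_nonneg hp (avoidAll ends a₂ {a₁} ∩ connEvent ends a₁ o)
  have hH := prob_nonneg hp (avoidAll ends a₂ {a₁} ∩ connEvent ends a₂ o)
  nlinarith [mul_nonneg (add_nonneg hL hH) (neg_nonneg.2 cLH),
    mul_nonneg (add_nonneg hL hH) (neg_nonneg.2 cHL)]

/-- **The mean field at a pendant `a₃` at `o` is `2q(1−q)·(A_L + A_H)·(s_LH + s_HL)`.** -/
theorem HMFc_pendant_o (hp : IsProbVec p) (hf : ends f = s(a₃, o))
    (hleaf : ∀ e, a₃ ∈ ends e → e = f) (h3o : a₃ ≠ o) {a₁ a₂ b : V} (h31 : a₃ ≠ a₁) (h32 : a₃ ≠ a₂)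
    (hb : b ≠ a₃) :
    HMFc p ends o a₁ a₂ a₃ b = 2 * p f * (1 - p f) *
      ((prob p (avoidAll ends a₂ {a₁} ∩ connEvent ends a₁ o) +
          prob p (avoidAll ends a₂ {a₁} ∩ connEvent ends a₂ o)) *
        ((prob p (avoidAll ends a₂ {a₁} ∩ connEvent ends a₁ o) *
              prob p (avoidAll ends a₂ {a₁} ∩ connEvent ends a₂ b) -
            prob p (avoidAll ends a₂ {a₁}) *
              prob p (avoidAll ends a₂ {a₁} ∩ connEvent ends a₂ b ∩ connEvent ends a₁ o)) +
          (prob p (avoidAll ends a₂ {a₁} ∩ connEvent ends a₂ o) *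
              prob p (avoidAll ends a₂ {a₁} ∩ connEvent ends a₁ b) -
            prob p (avoidAll ends a₂ {a₁}) *
              prob p (avoidAll ends a₂ {a₁} ∩ connEvent ends a₁ b ∩ connEvent ends a₂ o)))) := by
  have h13 : a₁ ≠ a₃ := Ne.symm h31
  have h23 : a₂ ≠ a₃ := Ne.symm h32
  have ho3 : o ≠ a₃ := Ne.symm h3o
  have c₁o := free_connEvent hf hleaf h3o h13 ho3
  have c₂o := free_connEvent hf hleaf h3o h23 ho3
  have c₁b := free_connEvent hf hleaf h3o h13 hb
  have c₂b := free_connEvent hf hleaf h3o h23 hb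
  have ht := termW_leaf_o p ends hp hf hleaf h3o h31 h32 hb
  have hX := Xhat_pendant_o p ends hf hleaf h3o a₁ a₂ b
  -- the empty and absorbed atoms (`b := o` in the pendant-`b` lemmas)
  have eHL : avoidAll ends a₂ {a₁} ∩ connEvent ends a₂ o ∩ connEvent ends a₁ o = ∅ :=
    Q_bH_bL_empty ends a₁ a₂
  have eLH : avoidAll ends a₂ {a₁} ∩ connEvent ends a₁ o ∩ connEvent ends a₂ o = ∅ :=
    Q_bL_bH_empty ends a₁ a₂
  have eNH : avoidAll ends a₂ {a₁} ∩ bN ends a₁ a₂ o ∩ connEvent ends a₂ o = ∅ :=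
    Q_bN_bH_empty ends a₁ a₂
  have eNL : avoidAll ends a₂ {a₁} ∩ bN ends a₁ a₂ o ∩ connEvent ends a₁ o = ∅ :=
    Q_bN_bL_empty ends a₁ a₂
  unfold HMFc marginC DEF EQo EQ3 EQ3o Do massM2 deltaT
  rw [gap_eq_Q, hX, Set.inter_comm (connEvent ends a₂ b) (TEvent ends a₁ a₂ a₃),
    Set.inter_comm (connEvent ends a₁ b) (TEvent ends a₁ a₂ a₃)]
  simp only [prob_PD_inter_b p hf hleaf h3o h31 h32 c₁o, prob_PD_inter_b p hf hleaf h3o h31 h32 c₂o,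
    prob_PD_inter_b p hf hleaf h3o h31 h32 c₂b,
    prob_T_inter_b p hf hleaf h3o h31 h32 c₁o, prob_T_inter_b p hf hleaf h3o h31 h32 c₂o,
    prob_T_inter_b p hf hleaf h3o h31 h32 c₁b, prob_T_inter_b p hf hleaf h3o h31 h32 c₂b,
    prob_T'_inter_b p hf hleaf h3o h31 h32 c₁o, prob_T'_inter_b p hf hleaf h3o h31 h32 c₂o,
    prob_PD_b p ends hf hleaf h3o h31 h32, prob_T_b p ends hf hleaf h3o h31 h32,
    prob_T'_b p ends hf hleaf h3o h31 h32,
    eHL, eLH, eNH, eNL, prob_empty]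
  simp only [inter_self_right]
  have s1 := prob_bN_split p ends (b := o) a₁ a₂ (connEvent ends a₂ b)
  have s3 := prob_bN_split p ends (b := o) a₁ a₂ Set.univ
  simp only [Set.inter_univ] at s3
  rw [s1, s3, Set.inter_right_comm (avoidAll ends a₂ {a₁}) (connEvent ends a₁ o) (connEvent ends a₂ b),
    Set.inter_right_comm (avoidAll ends a₂ {a₁}) (connEvent ends a₂ o) (connEvent ends a₁ b)]
  linear_combination (-2 * (1 - p f) * (prob p (avoidAll ends a₂ {a₁}) -
    p f * (prob p (avoidAll ends a₂ {a₁} ∩ connEvent ends a₁ o) +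
      prob p (avoidAll ends a₂ {a₁} ∩ connEvent ends a₂ o)))) * ht

/-- **THEOREM: (HMF) holds at every pendant `a₃` at `o`** — from the cross-cluster BHK inequalities
alone: `HMFc = 2q(1−q)·(A_L + A_H)·(s_LH + s_HL)`. -/
theorem HMF_pendant_o (hp : IsProbVec p) (hf : ends f = s(a₃, o))
    (hleaf : ∀ e, a₃ ∈ ends e → e = f) (h3o : a₃ ≠ o) {a₁ a₂ b : V} (h31 : a₃ ≠ a₁) (h32 : a₃ ≠ a₂)
    (hb : b ≠ a₃) : HMF p ends o a₁ a₂ a₃ b := by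
  unfold HMF
  rw [HMFc_pendant_o p ends hp hf hleaf h3o h31 h32 hb]
  have hq0 := hp.nonneg f
  have hq1 := sub_nonneg.2 (hp.le_one f)
  have := attO_nonneg p ends hp o a₁ a₂ b
  have hq : 0 ≤ 2 * p f * (1 - p f) := by positivity
  exact mul_nonneg hq this

/-- **(HCOV) at every pendant `a₃` at `o`, via the mean field** (a second proof of the pendant-`o`
attachment case, `HCov_of_HMF`). -/
theorem HCov_pendant_o' (hp : IsProbVec p) (hf : ends f = s(a₃, o))
    (hleaf : ∀ e, a₃ ∈ ends e → e = f) (h3o : a₃ ≠ o) {a₁ a₂ b : V} (h31 : a₃ ≠ a₁) (h32 : a₃ ≠ a₂)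
    (hb : b ≠ a₃) : HCov p ends o a₁ a₂ a₃ b :=
  HCov_of_HMF p hp ends o a₁ a₂ a₃ b (HMF_pendant_o p ends hp hf hleaf h3o h31 h32 hb)

end HMFPendantO

end Summit.Ventures.PercRepro2
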